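import Summits.ResolutionOfSingularities.ResolutionOfSingularities.Theorems.PAlterationPicoverOfDegP
import Literature.AlgebraicGeometry.Resolution.LogRegularScheme

/-!
# Crux `CleanModelsSuffice` (stmt-ResolutionOfSingularities-15883), line `Sketch` — two proved frame pieces

Route `ResolutionOfSingularities/RadicialJung`, crux `CleanModelsSuffice`. Two sorry-free pieces of the line's skeleton
(`Cruxes/CleanModelsSuffice/Lines/Sketch.lean`), landed on their own so that the reduction theorem and the final assembly
can import them:

* `picoverAt_of_degPAt` — at a FIXED prime `p`, the degree-`p` residue (`PicoverDegP_p`) implies `PICover_p` (Temkin's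
  degree-`p` tower, `Picover.OfDegP.hasResolution_normalizationIn_of_finrank_eq_pow`, and the comparison `Y^{K(X)} → X`,
  `Picover.OfNormalizationIn.stub_ofNormalizationIn`; the tree's `picover_of_picoverDegP` is the all-primes form);
* `atlasOfCharts` — on a quasi-compact locally Noetherian scheme, pointwise fs charts that are Kato-log-regular at every stalk
  and pairwise compatible assemble (finite subcover) into a `LogAtlas` which `IsLogRegular` — the hypothesis shape of the
  vendored `Kato1994_logRegularScheme_hasResolution`.
-/

noncomputable section

set_option linter.dupNamespace false -- mandated namespace of this single-conjunct summit

open CategoryTheory CategoryTheory.Limits AlgebraicGeometry TopologicalSpace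
open Literature.AlgebraicGeometry.Resolution Literature.AlgebraicGeometry.Motives
open Summit.ResolutionOfSingularities.ResolutionOfSingularities.Theorems.Picover

namespace Summit.ResolutionOfSingularities.ResolutionOfSingularities.Theorems.RadicialJung.CleanModelsSuffice

/-- **Assembly of a log-regular atlas from compatible pointwise charts.** On a quasi-compact,
locally Noetherian scheme, a family of opens covering `X` with fs charts that are log regular at every
stalk (Kato (2.1)) and pairwise compatible on overlaps yields, after passing to a finite subcover, a
`LogAtlas` which `IsLogRegular`. [folklore] -/
theorem atlasOfCharts (X : Scheme.{0}) [CompactSpace X] (hN : IsLocallyNoetherian X)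
    (ι : Type) (W : ι → X.Opens) (n : ι → ℕ) (P : ∀ i, AddSubmonoid (Fin (n i) → ℤ))
    (φ : ∀ i, Multiplicative (P i) →* Γ(X, W i)) (hcover : ∀ x : X, ∃ i, x ∈ W i)
    (hP : ∀ i, (P i).FG ∧ (P i).NSMulSaturated ∧
      Submodule.span ℤ (P i : Set (Fin (n i) → ℤ)) = ⊤)
    (hreg : ∀ i (x : X) (hx : x ∈ W i), LogChart.IsLogRegularLocal (P i)
      ((X.presheaf.germ (W i) x hx).hom.toMonoidHom.comp (φ i)))
    (hcompat : ∀ i j (x : X) (hi : x ∈ W i) (hj : x ∈ W j) (c : P i), ∃ c' : P j,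
      Associated (X.presheaf.germ (W i) x hi (φ i (Multiplicative.ofAdd c)))
        (X.presheaf.germ (W j) x hj (φ j (Multiplicative.ofAdd c')))) :
    ∃ 𝒜 : LogAtlas.{0} X, 𝒜.IsLogRegular := by
  -- a finite subcover
  obtain ⟨T, hT⟩ := isCompact_univ.elim_finite_subcover (fun i => ((W i : X.Opens) : Set X))
    (fun i => (W i).isOpen) (fun x _ => Set.mem_iUnion.2 (hcover x))
  let 𝒜 : LogAtlas.{0} X :=
    { ι := {i // i ∈ T}
      U := fun i => W i.1
      exists_mem := fun x => by
        have hx := hT (Set.mem_univ x)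
        simp only [Set.mem_iUnion] at hx
        obtain ⟨i, hi, hxi⟩ := hx
        exact ⟨⟨i, hi⟩, hxi⟩
      rk := fun i => n i.1
      P := fun i => P i.1
      fg := fun i => (hP i.1).1
      saturated := fun i => (hP i.1).2.1
      span_eq_top := fun i => (hP i.1).2.2
      chart := fun i => φ i.1
      chart_compatible := fun i j x hi hj c => hcompat i.1 j.1 x hi hj c }
  exact ⟨𝒜, ⟨hN, fun i x hx => hreg i.1 x hx⟩⟩

/-! ## Frame: `PICover_p` from the degree-`p` residue at the fixed prime -/

/-- At a fixed prime `p`: if the normalisation of every regular integral separated finite-type `W/k`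
(`char k = p`) in every purely inseparable degree-`p` extension of `K(W)` has a resolution, then every
integral `X` finite, universally injective and surjective over such a `Y` has a resolution (Temkin's
degree-`p` tower, `Picover.OfDegP.hasResolution_normalizationIn_of_finrank_eq_pow`, and the comparison
`Y^{K(X)} → X`, `Picover.OfNormalizationIn.stub_ofNormalizationIn`). [cite: Temkin2013, Rem. 1.3.5 (ii)] -/
theorem picoverAt_of_degPAt (p : ℕ) (hp : p.Prime)
    (hDegP : ∀ (k : Type) [Field k] [CharP k p] (W : Scheme.{0}) [IsIntegral W]
      (f : W ⟶ Spec (.of k)) (L : Type) [Field L] [Algebra W.functionField L],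
      IsSeparated f → LocallyOfFiniteType f → QuasiCompact f → Scheme.IsRegular W →
      IsPurelyInseparable W.functionField L → Module.finrank W.functionField L = p →
      Scheme.HasResolution (normalizationIn W L)) :
    ∀ (k : Type) [Field k] [CharP k p] (Y X : Scheme.{0}) (f : Y ⟶ Spec (.of k)) (g : X ⟶ Y),
      IsSeparated f → LocallyOfFiniteType f → QuasiCompact f → IsIntegral Y → Scheme.IsRegular Y →
      IsIntegral X → IsFinite g → UniversallyInjective g → Function.Surjective g.base →
      Scheme.HasResolution X := by
  intro k _ _ Y X f g hsep hlft hqc hY hYreg hX hfin hui hsurj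
  haveI : Fact p.Prime := ⟨hp⟩
  haveI : IsDominant g := ⟨hsurj.denseRange⟩
  haveI : CharP Y.functionField p := TowerTransport.charP_functionField Y f
  haveI : ExpChar Y.functionField p := ExpChar.prime hp
  haveI : IsPurelyInseparable Y.functionField (FunctionFieldOver g) :=
    FunctionFieldRadicial.stub_functionFieldRadicial X Y g
  obtain ⟨n, hn⟩ := IsPurelyInseparable.finrank_eq_pow Y.functionField (FunctionFieldOver g) p
  have hN : Scheme.HasResolution (normalizationIn Y (FunctionFieldOver g)) :=
    OfDegP.hasResolution_normalizationIn_of_finrank_eq_pow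
      (fun W _ f L _ _ hs hl hq hr hpi hd => hDegP k W f L hs hl hq hr hpi hd) Y f hYreg n
      (FunctionFieldOver g) hn
  exact OfNormalizationIn.stub_ofNormalizationIn k X Y f g
    (FunctionFieldNormalizationIn.stub_functionField_normalizationIn Y (FunctionFieldOver g)) hN

end Summit.ResolutionOfSingularities.ResolutionOfSingularities.Theorems.RadicialJung.CleanModelsSuffice

end
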